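import Literature.MathematicalPhysics.QuantumFieldTheory.Balaban1983to89.B9Eq3105FamThreeLocDiffG
import Literature.MathematicalPhysics.QuantumFieldTheory.Balaban1983to89.B9Cor36SiteSandwichTransferSrcGlobal
import Literature.MathematicalPhysics.QuantumFieldTheory.Balaban1983to89.B9ThmDCubeSideKernels

/-!
# `Balaban1983to89.B9Eq3105FamThreeCommStepMember` — FAMILY 3 OF (3.105): THE COMMUTATOR LETTER `R_χ = [M_{χ_□}, Δ′_{a,□}]·G′_□` OF F3-E1's ONE-SIDED
# IDENTITY, READ AT THE CONSUMER's FIELD `Ṽ_□^{u⁻¹}` AND TRANSFERRED TO THE MEMBER's SITE CARRIER WITH GLOBAL SOURCES — from p21 D3∕D4's cube-carrier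
# majorant `conj b(R_χ(Ṽ)) ≺ θ_R·e^{−δd_□}`: `conj b(R_χ(Ṽ^{u⁻¹})^ℝ) ≺ (M₂Σ‖b_j‖)²·θ_R·c₁(δ, α)·e^{−(1−α)δ·d(a,a′)}` over `(toB6 (geo9K i) Rr′ Hp, ιB∘blkOf)`, its rows in
# the transition annulus — the input `hT`∕`hTm` of F3-E2's engine `hasMajorant_commPiece` (sub-row G-B9-LETTERS, GAPS G-B9-05∕G-B9-p33-01, programme
# FAMTHREE FILE F3-E2b; design `lit-balaban-p33/g103/F3E-SCOPE.md`)

statement-level skeleton of published theorems with citation tags; proofs where landed; nothing here is a claim about the Yang–Mills mass gap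

THE PRINTED LOCUS (verbatim, held `paper:balaban1985-cmp99-background-propagators`, journal page = PDF page + 388).  (3.88)–(3.89) p. 409 (the commutator
letter `K(h)` of a slowly varying cut-off, «give small factors O(M⁻¹)» p. 412); p. 412 l.1–9 and l.22–36 («the operators may differ outside □̃₀»); p. 415 l.29–31;
(3.31)–(3.33) pp. 395–396 (gauge covariance «G′(U^u) = R(u)G′(U)R(u⁻¹)»); Cor. 3.6 p. 408 («U′ = U^u = e^{iηA}»); [4] (2.51)–(2.52) p. 232, Lemma 2.1 (2.61) p. 234.

WHAT THIS FILE CERTIFIES (kernel-checked; 0 `def`, 0 `def … : Prop`, 0 sorry; standard axioms only)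

* §1 (covariance) `GpCubeY_gauge_inv_eq` (`G′_□(V^{g⁻¹}) = R(g)⁻¹G′_□(V)R(g)`), ★ `commStep_gauge_inv_eq` (`R_χ(V^{g⁻¹}) = R(g)⁻¹·R_χ(V)·R(g)`, `M_{χ_□}` commuting with `R(g)`).
* §2 (rows) `cutMulY_transInd_mul_commStep` (`M_{1_A}·R_χ(V) = R_χ(V)` for the site indicator `1_A` of the transition annulus `¬NearC(3S_j − L^{j+1})`: the rows
  inside the plateau vanish, p21 `commStep_apply_eq_zero_of_nearC`), `mulOp_transInd_mul_conj_commStep` (the same in real coordinates — the engine's `hTm`),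
  `transIndSite_mem` (the annulus rows lie in the member blocks `Zm_□` — the engine's `hm0`).
* §3 ★★ `hasMajorant_conj_commStep_member` — THE TRANSFER: from `hR : conj b(R_χ(Ṽ)^ℝ) ≺ θ_R·e^{−δd_□}` over `(toB6 (geoCK i □) Rr H, blkCubeY)`, a bi-contractive
  `g`, the cube (2.61) at `(δ, α)`: `conj b(R_χ(Ṽ^{g⁻¹})^ℝ) ≺ (M₂Σ‖b_j‖)²·(θ_R·c₁(dB, δ, α))·e^{−(1−α)δ·d}` over `(toB6 (geo9K i) Rr′ Hp, ιB∘blkOf)` (p21 g58's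
  `hasMajorant_conj_site_sandwich_src_global` with `g₁ = 1_A`, `G₁ = 1_T`, `w = 1`).

HONEST SCOPE ∕ NOT CLAIMED.  `hR` is DISPLAYED (supplier: p21 D3 `B9ThmDCommutatorStep.hasMajorant_conj_commStep` at the datum from the cube's (3.42)∕(3.49) data,
as D4∕D5∕D6 use it); the smallness «O(M⁻¹)» of (3.89) sits inside `θ_R` and is not re-derived; no inequality of [B9]∕[2] beyond the transfer.  Count-neutral;
NOT a node discharge; no summit ∕ sub-problem statement is proved; nothing continuum ∕ OS ∕ mass-gap ∕ Clay; YM mass gap NOT proved (Track A conditional rung).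
No `sorry`, no `axiom`, no `… : Prop` fact, no `instance`, no `notation`, no `def`.  NEW file; nothing landed is modified.  Cell `lit-balaban`, seat
`lit-balaban-p33` gen 103, 2026-08-29; `--supports stmt-QuantumFields-19200` as helper.  Net new unproved facts: 0.

RELATED IN THE TREE, NOT DUPLICATED (searched 2026-08-29: `rg 'commStep_member|commStep_gauge_inv' Literature/` = ∅): p21 `B9ThmDCommutatorStep` (D3),
`B9ThmDCubeSideKernels` (D4: `transInd`, `hasMajorant_conj_commStep_trans`), `B9ThmDLocDiffMajorants` (D5: `transfer_commStep`, the SOURCES-NEAR transfer of the same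
letter), p21 g58 `B9Cor36SiteSandwichTransferSrcGlobal` — all USED BY NAME; this file is the sources-GLOBAL twin of D5's `transfer_commStep`.
-/

noncomputable section

namespace Literature.MathematicalPhysics.QuantumFieldTheory.Balaban1983to89.B9Eq3105FamThreeCommStepMember

open NormedSpace Complex
open B6RandomWalk (HasMajorant hasMajorant_mono Ineq261 c1_nonneg)
open B9Thm34Ext (toB6)
open B9Thm37Sum (mulOp mulOp_apply)
open B9Eq352DivFormLetters (conj)
open B9Eq39Adjoint (R)
open B9Eq310Hermitian (norm_R_le norm_R_inv_le)
open B6KLevelCensusIndexV1 (KIdx)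
open B6Cover236MultiLevelBlocks (cubes)
open B6Geom246MultiLevelBox (blkOf)
open B6Ineq2142KLevelV1 (β)
open B9GeoNormsKLevelV1 (geo9K)
open B9Eq360DeltaPrimeACubeY (blkCubeY)
open B9CubeGeometryInputs (geoCK)
open B9CubeLettersOpsL0 (deltaPrimeACubeY GpCubeY)
open B9CubeLettersBondOpsL0 (BlkCubeY)
open B9CubeLettersCovarianceL0 (GpCubeY_cov)
open B9Thm37CubeCoverCommutators (cutMulY cutMulY_apply)
open B9Thm39CinvTorusRegular (conj_cutMulY)
open B9Cor36CubeCutoffs (SC NearC chiY)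
open B9Cor36CubeTwinsGeometry (bS)
open B9Cor36GpCubeLocLetter (conjY_inv_mul_conjY conjY_mul_conjY_inv cutMulY_mul_conjY)
open B9Cor36SiteSandwichTransferSrcGlobal (hasMajorant_conj_site_sandwich_src_global)
open B9ThmDCommutatorStep (commStep_apply_eq_zero_of_nearC)
open B9ThmDCubeSideKernels (transInd transInd_eq_one transInd_nonneg_le_one)
open B9Eq3105FamThreeLocDiffG (deltaPrimeACubeY_gauge_inv_eq)
open Node00 (SiteY BlkY IBondY CfgY GaugeY SiteParY toKT conjY gSiteY gaugeY IsGaugeLawS)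

variable {d ℓ : ℕ} {hd : 1 ≤ d + 1} {hL : Odd (ℓ + 1) ∧ 1 < ℓ + 1} {b₀ b₁ : ℝ}
variable {𝔸 : Type} [NormedRing 𝔸] [NormedAlgebra ℂ 𝔸] [CompleteSpace 𝔸]
variable {ι : Type} [Fintype ι]
variable (i : KIdx d ℓ hd hL b₀ b₁) (c : ↥(cubes (toKT i).D.toDomains))

/-! ## §1  Covariance of the commutator letter -/

section Covariance

/-- (3.33) for the cube letter at the gauged-back field: `G′_□(V^{g⁻¹}) = R(g)⁻¹·G′_□(V)·R(g)`. [cite: Balaban1985BackgroundPropagators, (3.33) p.396, p.409 l.3–5] -/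
theorem GpCubeY_gauge_inv_eq {parS : SiteParY 𝔸 i} (hS : IsGaugeLawS i parS) (g : GaugeY 𝔸 i) (V : CfgY 𝔸 i) :
    GpCubeY i c parS (gaugeY i g⁻¹ V) = conjY (gSiteY i g)⁻¹ * GpCubeY i c parS V * conjY (gSiteY i g) := by
  have h : GpCubeY i c parS (gaugeY i g⁻¹ V) * conjY (gSiteY i g)⁻¹ = conjY (gSiteY i g)⁻¹ * GpCubeY i c parS V := GpCubeY_cov c g⁻¹ V hS
  rw [← h, mul_assoc, conjY_inv_mul_conjY, mul_one]

/-- ★ **`R_χ(V^{g⁻¹}) = R(g)⁻¹·R_χ(V)·R(g)`** for `R_χ(W) = (M_{χ_□}Δ′_{a,□}(W) − Δ′_{a,□}(W)M_{χ_□})·G′_□(W)` (`M_{χ_□}` commutes with `R(g)`).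
[cite: Balaban1985BackgroundPropagators, (3.31)–(3.33) pp.395–396, (3.88) p.409] -/
theorem commStep_gauge_inv_eq {parS : SiteParY 𝔸 i} (hS : IsGaugeLawS i parS) (g : GaugeY 𝔸 i) (V : CfgY 𝔸 i) :
    (cutMulY (𝔸 := 𝔸) (chiY i c) * deltaPrimeACubeY i c parS (gaugeY i g⁻¹ V) - deltaPrimeACubeY i c parS (gaugeY i g⁻¹ V) * cutMulY (𝔸 := 𝔸) (chiY i c)) *
        GpCubeY i c parS (gaugeY i g⁻¹ V) =
      conjY (gSiteY i g)⁻¹ * ((cutMulY (𝔸 := 𝔸) (chiY i c) * deltaPrimeACubeY i c parS V - deltaPrimeACubeY i c parS V * cutMulY (𝔸 := 𝔸) (chiY i c)) *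
        GpCubeY i c parS V) * conjY (gSiteY i g) := by
  rw [deltaPrimeACubeY_gauge_inv_eq i c hS g V, GpCubeY_gauge_inv_eq i c hS g V]
  set Γ : Module.End ℂ (SiteY i → 𝔸) := conjY (gSiteY i g)
  set Γi : Module.End ℂ (SiteY i → 𝔸) := conjY (gSiteY i g)⁻¹
  set C : Module.End ℂ (SiteY i → 𝔸) := cutMulY (𝔸 := 𝔸) (chiY i c)
  set Δ : Module.End ℂ (SiteY i → 𝔸) := deltaPrimeACubeY i c parS V
  set G : Module.End ℂ (SiteY i → 𝔸) := GpCubeY i c parS V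
  have e1 : C * Γi = Γi * C := cutMulY_mul_conjY i _ _
  have e2 : C * Γ = Γ * C := cutMulY_mul_conjY i _ _
  have hΓΓi : Γ * Γi = 1 := conjY_mul_conjY_inv i (gSiteY i g)
  have s1 : C * (Γi * Δ * Γ) = Γi * (C * Δ) * Γ := by rw [← mul_assoc, ← mul_assoc, e1, mul_assoc Γi C Δ]
  have s2 : Γi * Δ * Γ * C = Γi * (Δ * C) * Γ := by rw [mul_assoc (Γi * Δ) Γ C, ← e2, ← mul_assoc, mul_assoc Γi Δ C]
  rw [s1, s2, ← sub_mul, ← mul_sub]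
  calc Γi * (C * Δ - Δ * C) * Γ * (Γi * G * Γ) = Γi * (C * Δ - Δ * C) * (Γ * Γi) * G * Γ := by simp only [mul_assoc]
    _ = _ := by rw [hΓΓi, mul_one]; simp only [mul_assoc]

end Covariance

/-! ## §2  The rows of `R_χ` lie in the transition annulus -/

section Rows

open Classical in
/-- ★ **`M_{1_A}·R_χ(V) = R_χ(V)`** for the site indicator `1_A` of the transition annulus `¬NearC(3S_j − L^{j+1})`: the rows of `R_χ` inside the plateau vanish.
[cite: Balaban1985BackgroundPropagators, (3.88) p.409, p.412 l.1–9 («the operators may differ outside □̃₀»)] -/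
theorem cutMulY_transInd_mul_commStep (parS : SiteParY 𝔸 i) (V : CfgY 𝔸 i) :
    cutMulY (𝔸 := 𝔸) (fun z : SiteY i => if NearC i c (3 * SC i c - (bS i c : ℤ)) z.1 then (0 : ℝ) else 1) *
        ((cutMulY (𝔸 := 𝔸) (chiY i c) * deltaPrimeACubeY i c parS V - deltaPrimeACubeY i c parS V * cutMulY (𝔸 := 𝔸) (chiY i c)) * GpCubeY i c parS V) =
      (cutMulY (𝔸 := 𝔸) (chiY i c) * deltaPrimeACubeY i c parS V - deltaPrimeACubeY i c parS V * cutMulY (𝔸 := 𝔸) (chiY i c)) * GpCubeY i c parS V := by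
  refine LinearMap.ext fun Λ => funext fun z => ?_
  rw [Module.End.mul_apply, cutMulY_apply]
  by_cases hz : NearC i c (3 * SC i c - (bS i c : ℤ)) z.1
  · rw [if_pos hz, commStep_apply_eq_zero_of_nearC i c parS V Λ hz, smul_zero]
  · rw [if_neg hz, Complex.ofReal_one, one_smul]

open Classical in
/-- the same in real coordinates (`conj b`): the engine's `hTm`. [cite: Balaban1985BackgroundPropagators, (3.88) p.409; Balaban1984PropagatorsII, (2.51) p.232] -/
theorem mulOp_transInd_mul_conj_commStep (b : Module.Basis ι ℝ 𝔸) (parS : SiteParY 𝔸 i) (V : CfgY 𝔸 i) :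
    mulOp (fun p : SiteY i × ι => if NearC i c (3 * SC i c - (bS i c : ℤ)) p.1.1 then (0 : ℝ) else 1) *
        conj b (((cutMulY (𝔸 := 𝔸) (chiY i c) * deltaPrimeACubeY i c parS V - deltaPrimeACubeY i c parS V * cutMulY (𝔸 := 𝔸) (chiY i c)) *
          GpCubeY i c parS V).restrictScalars ℝ) =
      conj b (((cutMulY (𝔸 := 𝔸) (chiY i c) * deltaPrimeACubeY i c parS V - deltaPrimeACubeY i c parS V * cutMulY (𝔸 := 𝔸) (chiY i c)) *
        GpCubeY i c parS V).restrictScalars ℝ) := by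
  conv_rhs => rw [← cutMulY_transInd_mul_commStep i c parS V]
  rw [show ((cutMulY (𝔸 := 𝔸) (fun z : SiteY i => if NearC i c (3 * SC i c - (bS i c : ℤ)) z.1 then (0 : ℝ) else 1) *
      ((cutMulY (𝔸 := 𝔸) (chiY i c) * deltaPrimeACubeY i c parS V - deltaPrimeACubeY i c parS V * cutMulY (𝔸 := 𝔸) (chiY i c)) * GpCubeY i c parS V)).restrictScalars ℝ
      : Module.End ℝ (SiteY i → 𝔸)) =
      (cutMulY (𝔸 := 𝔸) (fun z : SiteY i => if NearC i c (3 * SC i c - (bS i c : ℤ)) z.1 then (0 : ℝ) else 1)).restrictScalars ℝ *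
        ((cutMulY (𝔸 := 𝔸) (chiY i c) * deltaPrimeACubeY i c parS V - deltaPrimeACubeY i c parS V * cutMulY (𝔸 := 𝔸) (chiY i c)) *
          GpCubeY i c parS V).restrictScalars ℝ from LinearMap.ext fun _ => rfl,
    B9Eq352DivFormLetters.conj_mul, conj_cutMulY]

omit [Fintype ι] in
open Classical in
/-- the annulus rows lie in the member blocks `Zm_□` meeting the annulus (the engine's `hm0`). [cite: Balaban1985BackgroundPropagators, p.412 l.1–9, bookkeeping] -/
theorem transIndSite_mem (ιB : BlkY i → IBondY i) (p : SiteY i × ι)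
    (hp : ιB (blkOf i.D.toDomains p.1) ∉
      (Finset.univ.filter fun a : IBondY i => ∃ z : SiteY i, ιB (blkOf i.D.toDomains z) = a ∧ ¬ NearC i c (3 * SC i c - (bS i c : ℤ)) z.1)) :
    (if NearC i c (3 * SC i c - (bS i c : ℤ)) p.1.1 then (0 : ℝ) else 1) = 0 := by
  by_cases hz : NearC i c (3 * SC i c - (bS i c : ℤ)) p.1.1
  · rw [if_pos hz]
  · exact absurd (Finset.mem_filter.2 ⟨@Finset.mem_univ _ (_) _, p.1, rfl, hz⟩) hp

end Rows

/-! ## §3  The source-global transfer to the member's site carrier -/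

section Transfer

variable (b : Module.Basis ι ℝ 𝔸) [Fintype (geo9K i).Site] {Rr : ℝ} {H : Prop} {Rr' : ℝ} {Hp : Prop}

open Classical in
set_option maxHeartbeats 1600000 in
/-- ★★ **THE COMMUTATOR LETTER ON THE MEMBER's CARRIER, SOURCES GLOBAL**: from p21 D3's cube-carrier majorant `conj b(R_χ(Ṽ)^ℝ) ≺ θ_R·e^{−δd_□}`, a
bi-contractive gauge `g`, and the cube (2.61) at `(δ, α)`:  `conj b(R_χ(Ṽ^{g⁻¹})^ℝ) ≺ (M₂Σ‖b_j‖)²·(θ_R·c₁(dB, δ, α))·e^{−(1−α)δ·d(a,a′)}` over `(toB6 (geo9K i) Rr′ Hp, ιB∘blkOf)`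
— the rows ride on the annulus indicator (`ℓ`-free weight), the far sources are split into cube pieces by `hasMajorant_conj_site_sandwich_src_global`.
[cite: Balaban1985BackgroundPropagators, (3.88)–(3.89) p.409, p.412 l.1–9, (3.31)–(3.33) pp.395–396, Cor. 3.6 p.408; Balaban1984PropagatorsII, (2.51)–(2.52) p.232, (2.46) p.231, Lemma 2.1 (2.61) p.234] -/
theorem hasMajorant_conj_commStep_member {M₂ : ℝ} (hM₂ : 0 ≤ M₂) (hrepr : ∀ (v : 𝔸) (j : ι), |b.repr v j| ≤ M₂ * ‖v‖)
    {parS : SiteParY 𝔸 i} (hS : IsGaugeLawS i parS) (g : GaugeY 𝔸 i) (hg : ∀ x, ‖((g x : 𝔸ˣ) : 𝔸)‖ ≤ 1 ∧ ‖(((g x)⁻¹ : 𝔸ˣ) : 𝔸)‖ ≤ 1) (V : CfgY 𝔸 i)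
    (ιB : BlkY i → IBondY i) (hι : ∀ s, β i.hN i.D i.hk (ιB s) = s) (dB : ℕ) {θ δ α : ℝ} (hθ : 0 ≤ θ) (hδ : 0 ≤ δ) (hα1 : α ≤ 1)
    (h261 : Ineq261 dB (toB6 (geoCK i c) Rr H) δ α)
    (hR : HasMajorant (g := toB6 (geoCK i c) Rr H) (fun p : SiteY i × ι => blkCubeY i c p.1)
      (conj b (((cutMulY (𝔸 := 𝔸) (chiY i c) * deltaPrimeACubeY i c parS V - deltaPrimeACubeY i c parS V * cutMulY (𝔸 := 𝔸) (chiY i c)) *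
        GpCubeY i c parS V).restrictScalars ℝ))
      (fun a s => θ * Real.exp (-(δ * (geoCK i c).dist a s)))) :
    HasMajorant (g := toB6 (geo9K i) Rr' Hp) (fun p : SiteY i × ι => ιB (blkOf i.D.toDomains p.1))
      (conj b (((cutMulY (𝔸 := 𝔸) (chiY i c) * deltaPrimeACubeY i c parS (gaugeY i g⁻¹ V) - deltaPrimeACubeY i c parS (gaugeY i g⁻¹ V) * cutMulY (𝔸 := 𝔸) (chiY i c)) *
        GpCubeY i c parS (gaugeY i g⁻¹ V)).restrictScalars ℝ))
      (fun a a' => (M₂ * ∑ j, ‖b j‖) ^ 2 * ((θ * B6.c1 dB δ α) * Real.exp (-((1 - α) * δ * (geo9K i).dist a a')))) := by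
  have hγ : ∀ (z : SiteY i) (a : 𝔸), ‖R (gSiteY i g z) a‖ ≤ ‖a‖ ∧ ‖R (gSiteY i g z)⁻¹ a‖ ≤ ‖a‖ := fun z a =>
    ⟨norm_R_le (hg _).1 (hg _).2 a, norm_R_inv_le (hg _).1 (hg _).2 a⟩
  -- the operator in the transfer's shape `M_{1_A} ∘ R(g)⁻¹ ∘ R_χ(Ṽ) ∘ R(g)`
  set M : Module.End ℝ (SiteY i → 𝔸) := ((cutMulY (𝔸 := 𝔸) (chiY i c) * deltaPrimeACubeY i c parS V -
    deltaPrimeACubeY i c parS V * cutMulY (𝔸 := 𝔸) (chiY i c)) * GpCubeY i c parS V).restrictScalars ℝ with hM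
  have hop : (((cutMulY (𝔸 := 𝔸) (chiY i c) * deltaPrimeACubeY i c parS (gaugeY i g⁻¹ V) -
        deltaPrimeACubeY i c parS (gaugeY i g⁻¹ V) * cutMulY (𝔸 := 𝔸) (chiY i c)) * GpCubeY i c parS (gaugeY i g⁻¹ V)).restrictScalars ℝ : Module.End ℝ (SiteY i → 𝔸)) =
      (cutMulY (𝔸 := 𝔸) (fun z : SiteY i => if NearC i c (3 * SC i c - (bS i c : ℤ)) z.1 then (0 : ℝ) else 1)).restrictScalars ℝ ∘ₗ
        (conjY (gSiteY i g)⁻¹).restrictScalars ℝ ∘ₗ M ∘ₗ (conjY (gSiteY i g)).restrictScalars ℝ := by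
    rw [← cutMulY_transInd_mul_commStep i c parS (gaugeY i g⁻¹ V), commStep_gauge_inv_eq i c hS g V]
    exact LinearMap.ext fun _ => rfl
  rw [hop]
  have hR' : HasMajorant (g := toB6 (geoCK i c) Rr H) (fun p : SiteY i × ι => blkCubeY i c p.1) (conj b M)
      (fun a s => θ * (fun _ : BlkCubeY i c => (1 : ℝ)) a * Real.exp (-(δ * (geoCK i c).dist a s))) :=
    hasMajorant_mono (g := toB6 (geoCK i c) Rr H) _ hR fun a s => le_of_eq (by rw [mul_one])
  refine hasMajorant_conj_site_sandwich_src_global i c b hM₂ hrepr (gSiteY i g) hγ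
    (fun z : SiteY i => if NearC i c (3 * SC i c - (bS i c : ℤ)) z.1 then (0 : ℝ) else 1) (transInd i c) (fun z => ?_)
    ιB hι Rr H Rr' Hp dB hθ hδ hα1 (fun _ => (1 : ℝ)) (fun _ => zero_le_one) h261 (fun z a' => ?_) M hR'
  · -- `|1_A(z)| ≤ 1_T(Δ_□ z)`
    by_cases hz : NearC i c (3 * SC i c - (bS i c : ℤ)) z.1
    · rw [if_pos hz, abs_zero]; exact (transInd_nonneg_le_one i c _).1
    · rw [if_neg hz, abs_one, transInd_eq_one i c hz]
  · -- the comparison: the indicator costs nothing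
    have hc1 : 0 ≤ B6.c1 dB δ α := c1_nonneg _ _ _
    have hexp : 0 ≤ Real.exp (-((1 - α) * δ * (geo9K i).dist (ιB (blkOf i.D.toDomains z)) a')) := Real.exp_nonneg _
    have h1 := (transInd_nonneg_le_one i c (blkCubeY i c z)).2
    have h0 := (transInd_nonneg_le_one i c (blkCubeY i c z)).1
    calc transInd i c (blkCubeY i c z) * 1 * (θ * B6.c1 dB δ α) * Real.exp (-((1 - α) * δ * (geo9K i).dist (ιB (blkOf i.D.toDomains z)) a'))
        ≤ 1 * 1 * (θ * B6.c1 dB δ α) * Real.exp (-((1 - α) * δ * (geo9K i).dist (ιB (blkOf i.D.toDomains z)) a')) :=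
          mul_le_mul_of_nonneg_right (mul_le_mul_of_nonneg_right (mul_le_mul_of_nonneg_right h1 zero_le_one) (mul_nonneg hθ hc1)) hexp
      _ = _ := by ring

end Transfer

end Literature.MathematicalPhysics.QuantumFieldTheory.Balaban1983to89.B9Eq3105FamThreeCommStepMember

end
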